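import Summits.HodgeConjecture.HodgeConjecture.Theorems.HLiu418FaltingsTateOfCMType
import Literature.NumberTheory.Automorphic.Liu2021.AppendixC.RestOneCMType
import HarnessLib

/-!
# Faltings–Tate for the pairs `(Alb Sh(𝕍)_K, A_μ)` from «the level-`K` Albanese is of CM type over `ℂ`»

Summit `HodgeConjecture`, binder `hLiu418` (item stmt-HodgeConjecture-24832).  The `hLiu418` cone consumes [Fal83, §5 Kor. 1]
ONLY through the binder
`hF : ∀ (K : C5.SmallLevel C.S.K₀) (obj : ObjOne φ ιE hμ hw Car), faltings_tate_bijective (C.A K) (AμOne φ ιE hμ hw Car obj) ℓ`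
of `Literature.NumberTheory.Automorphic.Liu2021.AppendixC.faltingsIsotypic_of_isInducedBy` ([Liu2021, proof of Thm. 4.18]):
Faltings–Tate bijectivity for the pairs (level-`K` Albanese `C.A K` of a §4.2 datum, the [Liu2021] Def. 4.5 CM abelian variety
`A_μ`).  THIS FILE discharges that binder from ONE hypothesis on the Albanese side,
`halb : ∀ K, IsOfCMType ((C.A K).baseChange ℂ)` — «`Alb(Sh(𝕍)_K) ⊗ ℂ` is of CM type», for an ARBITRARY ambient `ℂ`-algebra
structure on `E` (instance-polymorphic: no `letI` inside the binder) — by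

* `Theorems.faltings_tate_bijective_of_isOfCMType` — [Fal83, §5 Kor. 1] for every pair of abelian varieties over a number field
  whose complexifications are of CM type, UNCONDITIONALLY (heights-free: Pohlmann / Shimura–Taniyama through the tree's theorem
  `shimura1998_thm18_6_holds`);
* `Liu2021.AppendixC.RestOne.isOfCMType_baseChange_aμOne` — the `A_μ` side is of CM type over `ℂ` for any `[Algebra E ℂ]`
  ([Liu2021, Def. 4.5 (2)]: `i_μ : M_μ →+* End⁰(A_μ)`, `[M_μ : ℚ] = 2 dim A_μ`).

So the [Fal83] input of the cone reduces to the CM-type statement for the Albanese varieties of the compact unitary Shimura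
curves — the conclusion shape of [MurtyRamakrishnan1992, §2 Prop. 2] («`Alb(S̄_K)` is of potential CM type»), or of a
derivation from the multiplicity-one decomposition of `H¹` ([Liu2021, Cor. (co:cm_albanese)]); neither is asserted here
(`halb` is a hypothesis).  Theorems only; no definition, no named fact, no `sorry`; moves no floor binder.

## References
* [Faltings1983Endlichkeit] G. Faltings, *Endlichkeitssätze für abelsche Varietäten über Zahlkörpern*, Invent. Math. 73 (1983),
  §5 Korollar 1.
* [Liu2021] Y. Liu, *Fourier–Jacobi cycles and arithmetic relative trace formula*, Camb. J. Math. 9 (2021), Def. 4.5 (2), proof of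
  Thm. 4.18.
* [MurtyRamakrishnan1992] V. K. Murty, D. Ramakrishnan, *The Albanese of unitary Shimura varieties*, in: The zeta functions of
  Picard modular surfaces, CRM (1992), §2 Prop. 2.
* [Shimura1998] G. Shimura, *Abelian Varieties with Complex Multiplication and Modular Functions*, Princeton (1998), Thm. 18.6.
-/

-- mandated namespace `Summit.HodgeConjecture.HodgeConjecture.Theorems` trips `linter.dupNamespace` (single-problem summit);
-- off as in `HLiu418FaltingsTateOfCMType.lean`.
set_option linter.dupNamespace false

open CategoryTheory NumberField
open scoped NumberField

namespace Summit.HodgeConjecture.HodgeConjecture.Theorems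

open Literature.AlgebraicGeometry.Motives (AbelianVariety faltings_tate_bijective)
open Literature.AlgebraicGeometry.Milne1999 (IsOfCMType)
open Literature.NumberTheory.Automorphic Literature.NumberTheory.Automorphic.Liu2021
open Literature.NumberTheory.Automorphic.Liu2021.AppendixC

variable {F₀ E : Type} [Field F₀] [NumberField F₀] [IsTotallyReal F₀] [Field E] [NumberField E] [Algebra F₀ E]
  [IsTotallyComplex E] [Algebra.IsQuadraticExtension F₀ E] [IsCMField E]
variable {P5 : PropC5Data F₀ E} {isotropicAt : ℕ → Prop} (C : Sec42Data P5 isotropicAt)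
variable {L : Type} [Field L] [NumberField L] [IsGalois ℚ L] (φ : E →ₐ[ℚ] L) (ιE : L →+* ℂ)
variable {μ : IdeleClassGroup E →ₜ* Circle} (hμ : IdeleClassGroup.IsConjugateSymplectic E μ)
  (hw : IdeleClassGroup.HasWeight E μ 1) (Car : Def45.Carriers E μ)

/-- **The `hF` binder of `faltingsIsotypic_of_isInducedBy` from «every level-`K` Albanese is of CM type over `ℂ`»**
(instance-polymorphic in `[Algebra E ℂ]`; hypothesis `halb` = the conclusion shape of [MurtyRamakrishnan1992, §2 Prop. 2] /
[Liu2021, Cor. (co:cm_albanese)], NOT asserted here): for every prime `ℓ`, every small level `K` and every object `D_μ`,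
`faltings_tate_bijective (C.A K) (A_μ) ℓ` — `Theorems.faltings_tate_bijective_of_isOfCMType` with the `A_μ` side supplied by
`RestOne.isOfCMType_baseChange_aμOne`. [cite: Faltings1983Endlichkeit, §5 Korollar 1]
[cite: Liu2021, Def. 4.5 (2) (FJcycle.tex l. 1944–1950); Thm. 4.18 proof (FJcycle.tex l. 2245–2263)] -/
theorem hF_of_isOfCMType_alb [Algebra E ℂ]
    (halb : ∀ K : C5.SmallLevel C.S.K₀, IsOfCMType ((C.A K).baseChange ℂ)) (ℓ : ℕ) [Fact ℓ.Prime] :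
    ∀ (K : C5.SmallLevel C.S.K₀) (obj : RestOne.ObjOne φ ιE hμ hw Car),
      faltings_tate_bijective (C.A K) (RestOne.AμOne φ ιE hμ hw Car obj) ℓ :=
  fun K obj =>
    faltings_tate_bijective_of_isOfCMType (C.A K) (RestOne.AμOne φ ιE hμ hw Car obj) (halb K)
      (RestOne.isOfCMType_baseChange_aμOne φ ιE hμ hw Car obj) ℓ

end Summit.HodgeConjecture.HodgeConjecture.Theorems
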